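import Summits.QuantumFields.BalabanUV.T4Continuum.Support.CauchySumCrossoverThreshold

/-!
# CauchySumCrossoverThresholdW — the T4-DAG writer's OWN (n-weighted) (β)-surrogate `Σ_n min(a^n, n·M_K·Λ^n)`:
# upper bound and the full summability dichotomy `p·σ > 1` (= `p > (4+β)∕β` at `a = L^{−β}`, `Λ = L⁴`)
(cell `pub-balaban`, T4-DAG row `T4-U6.R-QCALC2°`, ruling §8 Q43 (c)∕(d2)∕(d4)(3); SIBLING of `Support/CauchySumCrossoverThreshold`
(p238660), which it imports and completes: that module proves the two-sided bound and the dichotomy for the UNWEIGHTED shape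
`Σ_n min(a^n, M·Λ^n)` and, for the weighted shape, only the lower bound `crossSumW_ge` and NON-summability
`not_summable_crossSumW`; here the weighted UPPER bound and SUMMABILITY for `p·σ > 1`, hence the dichotomy on the exact shape
of the writer's sentence.)

HONEST FRAMING (cell `pub-balaban`, page 1).  Rung (B)+1 of the FINITE-VOLUME T⁴ programme — NOT infinite volume, NOT a
mass gap, NOT the Clay problem; spine PROVED 0∕9.  ELEMENTARY REAL ANALYSIS on the T4-DAG WRITER'S SURROGATE for the naive
crossover reading (β) of the coupling channel («WRITER'S ARITHMETIC on the shape Σ_n min(a^n, n·M_K·Λ^n) with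
M_K := sup_{i≥K∕2} shift_i, NOT a census fact … summable for shift_k = O(k^{−p}) only when p·β∕(4+β) > 1, i.e. p > (4+β)∕β,
NOT p > 1», T4-DAG §8 Q43 (c), quoted for context); `M_K` is modelled as `c·(K+1)^{−p}` (`0 < c ≤ 1`, `p > 0`).  It asserts
NOTHING about Bałaban's renormalization-group objects, is NOT a statement about the kernel's `T4CauchySum.delta` ∕
`T4Crossover.crossoverDelta`, is NOT an estimate of any NE row, does NOT decide between the readings (α′) and (β) (§1 D6's
re-evaluation clause, a displayed U3∕NE5-type hypothesis), re-types no END and moves no label.  HONEST DEPENDENCY: continuum YM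
on T⁴ ⇐ BetaPertH ∧ nine spine estimates (0/9 proved); BetaPertH ⇐ (D1) ∧ (D4) ∧ CAP+tail; G-an2-4 gates asym, D1 and NE2/3/4.

WHAT IS PROVED (all [folklore]; notation of the sibling: `σ := log(1∕a)∕log(Λ∕a)`, `x* := log(1∕M)∕log(Λ∕a)`, `n₀ := ⌈x*⌉₊`).
* `crossSumW_le`: for `0 < a < 1 < Λ`, `0 < M ≤ 1`, all `N`:
  `Σ_{n<N} min(a^n, n·M·Λ^n) ≤ ((x*+1)·Λ∕(Λ−1) + 1∕(1−a))·M^σ` — the weight costs exactly one factor `n₀ ≤ x*+1 = O(log(1∕M))`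
  on the growth branch and nothing on the contraction branch (so «order M_K^σ» reads «order M_K^σ·log(1∕M_K)» for the
  weighted shape — same threshold).
* `crossIndex_shiftSize`: `x*(K) = log(1∕c)∕log(Λ∕a) + (p∕log(Λ∕a))·log(K+1)` for `M_K = c·(K+1)^{−p}`.
* `summable_crossSumW`: for `0 < a < 1 < Λ`, `0 < c ≤ 1`, `0 < p`, `1 < p·σ`:
  `Summable (K ↦ Σ_{n≤K} min(a^n, n·c(K+1)^{−p}·Λ^n))` (`log(K+1) ≤ (K+1)^ε∕ε` at `ε = (pσ−1)∕2`; two shifted p-series).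
* `crossSumW_L_dichotomy`: at `a = L^{−β}`, `Λ = L⁴` (`L > 1`, `β > 0`) the weighted surrogate is NOT summable for
  `p ≤ (4+β)∕β` (the sibling's `not_summable_crossSumW`) and IS summable for `p > (4+β)∕β`.
Imports EXACTLY the sibling; no definitions; no importer changes.  INTENT-ADDENDUM `CLAIMS.log` l.22370 (NE7b formalise leaf-08
g15; same idle-leaf volunteer slot of `T4-U6.R-QCALC2°` and same reading of record as the dagwriter's GO l.21896).
-/

namespace Summit.QuantumFields.BalabanUV.T4Continuum.CauchySumCrossoverThresholdW

open Finset
open Summit.QuantumFields.BalabanUV.T4Continuum.CauchySumCrossoverThreshold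

/-- **UPPER BOUND, n-weighted shape**: for `0 < a < 1 < Λ`, `0 < M ≤ 1` and every `N`,
`Σ_{n<N} min(a^n, n·M·Λ^n) ≤ ((x*+1)·Λ∕(Λ−1) + 1∕(1−a))·M^σ`, `x* = log(1∕M)∕log(Λ∕a)` — the n-weight costs one factor
`n₀ ≤ x*+1` on the growth branch and nothing on the contraction branch. [folklore] -/
theorem crossSumW_le {a Λ M : ℝ} (ha0 : 0 < a) (ha1 : a < 1) (hΛ1 : 1 < Λ) (hM0 : 0 < M) (hM1 : M ≤ 1) (N : ℕ) :
    ∑ n ∈ range N, min (a ^ n) ((n : ℝ) * M * Λ ^ n)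
      ≤ ((Real.log (1 / M) / Real.log (Λ / a) + 1) * (Λ / (Λ - 1)) + 1 / (1 - a))
          * M ^ (Real.log (1 / a) / Real.log (Λ / a)) := by
  have haΛ : a < Λ := ha1.trans hΛ1
  have hΛ0 : 0 < Λ := ha0.trans haΛ
  set x := Real.log (1 / M) / Real.log (Λ / a) with hx
  set σ := Real.log (1 / a) / Real.log (Λ / a) with hσ
  set n₀ := ⌈x⌉₊ with hn₀
  have hx0 : 0 ≤ x := crossIndex_nonneg ha0 haΛ hM0 hM1
  have hxn : x ≤ n₀ := Nat.le_ceil x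
  have hnx : (n₀ : ℝ) ≤ x + 1 := (Nat.ceil_lt_add_one hx0).le
  have hMσ : 0 ≤ M ^ σ := Real.rpow_nonneg hM0.le _
  -- growth branch below the crossover, with the weight `n ≤ n₀`
  have hA : ∑ n ∈ (range N).filter (fun n => n < n₀), min (a ^ n) ((n : ℝ) * M * Λ ^ n)
      ≤ (n₀ : ℝ) * (M * Λ ^ n₀ / (Λ - 1)) := by
    calc ∑ n ∈ (range N).filter (fun n => n < n₀), min (a ^ n) ((n : ℝ) * M * Λ ^ n)
        ≤ ∑ n ∈ (range N).filter (fun n => n < n₀), (n₀ : ℝ) * (M * Λ ^ n) := by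
          refine sum_le_sum fun n hn => (min_le_right _ _).trans ?_
          have hn' : (n : ℝ) ≤ n₀ := by
            simp only [mem_filter] at hn
            exact_mod_cast hn.2.le
          rw [mul_assoc]
          exact mul_le_mul_of_nonneg_right hn' (mul_nonneg hM0.le (pow_nonneg hΛ0.le _))
      _ ≤ ∑ n ∈ range n₀, (n₀ : ℝ) * (M * Λ ^ n) := by
          refine sum_le_sum_of_subset_of_nonneg ?_
            (fun n _ _ => mul_nonneg (Nat.cast_nonneg _) (mul_nonneg hM0.le (pow_nonneg hΛ0.le _)))
          intro n hn
          simp only [mem_filter, mem_range] at hn ⊢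
          exact hn.2
      _ = (n₀ : ℝ) * (M * ((Λ ^ n₀ - 1) / (Λ - 1))) := by rw [← mul_sum, ← mul_sum, geom_sum_eq hΛ1.ne']
      _ ≤ (n₀ : ℝ) * (M * (Λ ^ n₀ / (Λ - 1))) := by
          refine mul_le_mul_of_nonneg_left ?_ (Nat.cast_nonneg _)
          exact mul_le_mul_of_nonneg_left (div_le_div_of_nonneg_right (by linarith) (by linarith)) hM0.le
      _ = (n₀ : ℝ) * (M * Λ ^ n₀ / (Λ - 1)) := by ring
  -- contraction branch from the crossover on (no weight needed)
  have hB : ∑ n ∈ (range N).filter (fun n => ¬ n < n₀), min (a ^ n) ((n : ℝ) * M * Λ ^ n) ≤ a ^ n₀ / (1 - a) := by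
    calc ∑ n ∈ (range N).filter (fun n => ¬ n < n₀), min (a ^ n) ((n : ℝ) * M * Λ ^ n)
        ≤ ∑ n ∈ (range N).filter (fun n => ¬ n < n₀), a ^ n := sum_le_sum fun n _ => min_le_left _ _
      _ ≤ ∑ n ∈ Ico n₀ (n₀ + N), a ^ n := by
          refine sum_le_sum_of_subset_of_nonneg ?_ (fun n _ _ => pow_nonneg ha0.le _)
          intro n hn
          simp only [mem_filter, mem_range, not_lt] at hn
          simp only [mem_Ico]
          omega
      _ ≤ a ^ n₀ / (1 - a) := geom_sum_Ico_le_of_lt_one ha0.le ha1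
  have hA' : M * Λ ^ n₀ ≤ Λ * M ^ σ := by
    calc M * Λ ^ n₀ = M * Λ ^ (n₀ : ℝ) := by rw [Real.rpow_natCast]
      _ ≤ M * Λ ^ (x + 1) :=
          mul_le_mul_of_nonneg_left (Real.rpow_le_rpow_of_exponent_le hΛ1.le hnx) hM0.le
      _ = Λ * (M * Λ ^ x) := by rw [Real.rpow_add hΛ0, Real.rpow_one]; ring
      _ = Λ * M ^ σ := by rw [mul_rpow_crossIndex_eq ha0 haΛ hM0]
  have hB' : a ^ n₀ ≤ M ^ σ := by
    calc a ^ n₀ = a ^ (n₀ : ℝ) := (Real.rpow_natCast a n₀).symm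
      _ ≤ a ^ x := Real.rpow_le_rpow_of_exponent_ge ha0 ha1.le hxn
      _ = M ^ σ := rpow_crossIndex_eq ha0 haΛ hM0
  have hΛm : 0 < Λ - 1 := by linarith
  have ham : 0 < 1 - a := by linarith
  have hn0 : (0 : ℝ) ≤ n₀ := Nat.cast_nonneg _
  have hA'' : (n₀ : ℝ) * (M * Λ ^ n₀ / (Λ - 1)) ≤ (x + 1) * (Λ * M ^ σ / (Λ - 1)) :=
    mul_le_mul hnx (div_le_div_of_nonneg_right hA' hΛm.le) (by positivity) (by linarith)
  rw [← Finset.sum_filter_add_sum_filter_not (range N) (fun n => n < n₀)]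
  calc ∑ n ∈ (range N).filter (fun n => n < n₀), min (a ^ n) ((n : ℝ) * M * Λ ^ n)
        + ∑ n ∈ (range N).filter (fun n => ¬ n < n₀), min (a ^ n) ((n : ℝ) * M * Λ ^ n)
        ≤ (x + 1) * (Λ * M ^ σ / (Λ - 1)) + M ^ σ / (1 - a) :=
        add_le_add (hA.trans hA'') (hB.trans (div_le_div_of_nonneg_right hB' ham.le))
    _ = ((x + 1) * (Λ / (Λ - 1)) + 1 / (1 - a)) * M ^ σ := by ring

/-- The crossover index of `M_K = c·(K+1)^{−p}` in closed form: `x*(K) = log(1∕c)∕log(Λ∕a) + (p∕log(Λ∕a))·log(K+1)`.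
[folklore] -/
theorem crossIndex_shiftSize {a Λ c p : ℝ} (ha0 : 0 < a) (haΛ : a < Λ) (hc0 : 0 < c) (K : ℕ) :
    Real.log (1 / (c * ((K : ℝ) + 1) ^ (-p))) / Real.log (Λ / a)
      = Real.log (1 / c) / Real.log (Λ / a) + p / Real.log (Λ / a) * Real.log ((K : ℝ) + 1) := by
  have hD : Real.log (Λ / a) ≠ 0 := (log_ratio_pos ha0 haΛ).ne'
  have hK1 : 0 < (K : ℝ) + 1 := by positivity
  rw [one_div, Real.log_inv, Real.log_mul hc0.ne' (Real.rpow_pos_of_pos hK1 _).ne', Real.log_rpow hK1, one_div,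
    Real.log_inv]
  field_simp
  ring

/-- **THE n-WEIGHTED (β)-SURROGATE IS SUMMABLE WHEN `p·σ > 1`** (and `Λ > 1`): the weight's `log(K+1)` is absorbed by
`log(K+1) ≤ (K+1)^ε∕ε` at `ε = (pσ−1)∕2`, leaving two convergent shifted p-series. [folklore] -/
theorem summable_crossSumW {a Λ c p : ℝ} (ha0 : 0 < a) (ha1 : a < 1) (hΛ1 : 1 < Λ) (hc0 : 0 < c) (hc1 : c ≤ 1)
    (hp : 0 < p) (hpσ : 1 < p * (Real.log (1 / a) / Real.log (Λ / a))) :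
    Summable (fun K : ℕ => ∑ n ∈ range (K + 1), min (a ^ n) ((n : ℝ) * (c * ((K : ℝ) + 1) ^ (-p)) * Λ ^ n)) := by
  have haΛ : a < Λ := ha1.trans hΛ1
  have hΛ0 : 0 ≤ Λ := by linarith
  set σ := Real.log (1 / a) / Real.log (Λ / a) with hσ
  set A := Real.log (1 / c) / Real.log (Λ / a) with hA_def
  set B := p / Real.log (Λ / a) with hB_def
  set ε := (p * σ - 1) / 2 with hε
  have hε0 : 0 < ε := by rw [hε]; linarith
  have hD : 0 < Real.log (Λ / a) := log_ratio_pos ha0 haΛ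
  have hB0 : 0 ≤ B := div_nonneg hp.le hD.le
  have hq1 : 1 < p * σ - ε := by rw [hε]; linarith
  set C₁ := ((A + 1) * (Λ / (Λ - 1)) + 1 / (1 - a)) * c ^ σ with hC₁
  set C₂ := (B / ε) * (Λ / (Λ - 1)) * c ^ σ with hC₂
  have hmaj : Summable (fun K : ℕ => C₁ * ((K : ℝ) + 1) ^ (-(p * σ)) + C₂ * ((K : ℝ) + 1) ^ (-(p * σ - ε))) :=
    ((summable_succ_rpow_neg_iff.mpr hpσ).mul_left C₁).add ((summable_succ_rpow_neg_iff.mpr hq1).mul_left C₂)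
  refine Summable.of_nonneg_of_le (fun K => sum_nonneg fun n _ => ?_) (fun K => ?_) hmaj
  · exact le_min (pow_nonneg ha0.le _) (mul_nonneg (mul_nonneg (Nat.cast_nonneg _)
      (shiftSize_pos_le_one hc0 hc1 hp.le K).1.le) (pow_nonneg hΛ0 _))
  · obtain ⟨hM0, hM1⟩ := shiftSize_pos_le_one hc0 hc1 hp.le K
    have hK1 : 0 < (K : ℝ) + 1 := by positivity
    have h := crossSumW_le ha0 ha1 hΛ1 hM0 hM1 (K + 1)
    rw [crossIndex_shiftSize ha0 haΛ hc0 K, shiftSize_rpow hc0.le K] at h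
    have hlog : Real.log ((K : ℝ) + 1) ≤ ((K : ℝ) + 1) ^ ε / ε := Real.log_le_rpow_div hK1.le hε0
    have hpow : ((K : ℝ) + 1) ^ ε * ((K : ℝ) + 1) ^ (-(p * σ)) = ((K : ℝ) + 1) ^ (-(p * σ - ε)) := by
      rw [← Real.rpow_add hK1]; ring_nf
    have hcσ : 0 ≤ c ^ σ * ((K : ℝ) + 1) ^ (-(p * σ)) := by positivity
    have hΛq : 0 ≤ Λ / (Λ - 1) := div_nonneg hΛ0 (by linarith)
    calc ∑ n ∈ range (K + 1), min (a ^ n) ((n : ℝ) * (c * ((K : ℝ) + 1) ^ (-p)) * Λ ^ n)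
        ≤ ((A + B * Real.log ((K : ℝ) + 1) + 1) * (Λ / (Λ - 1)) + 1 / (1 - a))
            * (c ^ σ * ((K : ℝ) + 1) ^ (-(p * σ))) := h
      _ ≤ ((A + B * (((K : ℝ) + 1) ^ ε / ε) + 1) * (Λ / (Λ - 1)) + 1 / (1 - a))
            * (c ^ σ * ((K : ℝ) + 1) ^ (-(p * σ))) := by
          gcongr
      _ = C₁ * ((K : ℝ) + 1) ^ (-(p * σ)) + C₂ * (((K : ℝ) + 1) ^ ε * ((K : ℝ) + 1) ^ (-(p * σ))) := by
          rw [hC₁, hC₂]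
          field_simp
          ring
      _ = C₁ * ((K : ℝ) + 1) ^ (-(p * σ)) + C₂ * ((K : ℝ) + 1) ^ (-(p * σ - ε)) := by rw [hpow]

/-- **THE DICHOTOMY ON THE WRITER'S OWN (n-weighted) SHAPE.**  At `a = L^{−β}`, `Λ = L⁴` (`L > 1`, `β > 0`),
`M_K = c·(K+1)^{−p}` (`0 < c ≤ 1`, `p > 0`): `K ↦ Σ_{n≤K} min(L^{−βn}, n·M_K·L^{4n})` is NOT summable for `p ≤ (4+β)∕β`
(`not_summable_crossSumW`) and IS summable for `p > (4+β)∕β` — «summable for shift_k = O(k^{−p}) only when p > (4+β)∕β,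
NOT p > 1» (T4-DAG §8 Q43 (c)), two-sided, on the shape `Σ_n min(a^n, n·M_K·Λ^n)` as written there. [folklore] -/
theorem crossSumW_L_dichotomy {L β c p : ℝ} (hL : 1 < L) (hβ : 0 < β) (hc0 : 0 < c) (hc1 : c ≤ 1) (hp : 0 < p) :
    (p ≤ (4 + β) / β → ¬ Summable (fun K : ℕ => ∑ n ∈ range (K + 1),
        min ((L ^ (-β)) ^ n) ((n : ℝ) * (c * ((K : ℝ) + 1) ^ (-p)) * (L ^ (4 : ℝ)) ^ n))) ∧
    ((4 + β) / β < p → Summable (fun K : ℕ => ∑ n ∈ range (K + 1),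
        min ((L ^ (-β)) ^ n) ((n : ℝ) * (c * ((K : ℝ) + 1) ^ (-p)) * (L ^ (4 : ℝ)) ^ n))) := by
  have hL0 : 0 < L := by linarith
  have ha0 : 0 < L ^ (-β) := Real.rpow_pos_of_pos hL0 _
  have ha1 : L ^ (-β) < 1 := Real.rpow_lt_one_of_one_lt_of_neg hL (by linarith)
  have hΛ1 : 1 < L ^ (4 : ℝ) := Real.one_lt_rpow hL (by norm_num)
  have haΛ : L ^ (-β) < L ^ (4 : ℝ) := ha1.trans hΛ1
  have hσ := crossExp_L hL hβ
  have h4 : (0 : ℝ) < 4 + β := by linarith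
  refine ⟨fun hple => ?_, fun hlt => ?_⟩
  · refine not_summable_crossSumW ha0 ha1 haΛ hc0 hc1 hp ?_
    rw [hσ]
    have h1 : p * β ≤ 4 + β := (le_div_iff₀ hβ).mp hple
    have e : p * (β / (4 + β)) = p * β / (4 + β) := by ring
    rw [e, div_le_one h4]
    exact h1
  · refine summable_crossSumW ha0 ha1 hΛ1 hc0 hc1 hp ?_
    rw [hσ]
    have h1 : 4 + β < p * β := (div_lt_iff₀ hβ).mp hlt
    have e : p * (β / (4 + β)) = p * β / (4 + β) := by ring
    rw [e, lt_div_iff₀ h4]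
    linarith

/-- NON-VACUITY in the outside reader's numbers (ne7b-leaf-10-g20, C-ne7bleaf10g20-1 P3, on the parent): at `L = 2`, `β = 1`,
`c = 1` the threshold is `(4+1)∕1 = 5` — the weighted surrogate with the SUMMABLE shift `(K+1)^{−5}` DIVERGES, with
`(K+1)^{−6}` it converges. [folklore] -/
example : ¬ Summable (fun K : ℕ => ∑ n ∈ range (K + 1),
    min (((2 : ℝ) ^ (-(1 : ℝ))) ^ n) ((n : ℝ) * (1 * ((K : ℝ) + 1) ^ (-(5 : ℝ))) * ((2 : ℝ) ^ (4 : ℝ)) ^ n)) :=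
  (crossSumW_L_dichotomy (L := 2) (β := 1) (c := 1) (p := 5) (by norm_num) one_pos one_pos le_rfl (by norm_num)).1
    (by norm_num)

example : Summable (fun K : ℕ => ∑ n ∈ range (K + 1),
    min (((2 : ℝ) ^ (-(1 : ℝ))) ^ n) ((n : ℝ) * (1 * ((K : ℝ) + 1) ^ (-(6 : ℝ))) * ((2 : ℝ) ^ (4 : ℝ)) ^ n)) :=
  (crossSumW_L_dichotomy (L := 2) (β := 1) (c := 1) (p := 6) (by norm_num) one_pos one_pos le_rfl (by norm_num)).2
    (by norm_num)

end Summit.QuantumFields.BalabanUV.T4Continuum.CauchySumCrossoverThresholdW
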